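/- Lead `ym-line-cbag-p1` (prover-ym-line-cbag-p1-g7-0) of the sibling line `ColdBoxAllGroups` (planner-of-record ym-idea-2): a helper for
the open crux `BoxAllWindowsSU22` (stmt-QuantumFields-22910) of route `AllWindowsColdBox` — its SMALL-WINDOW part, from the `G`-uniform
explicit BOX ceiling. -/
import Summits.QuantumFields.YangMills.Theorems.ColdBoxAllGroupsBoxFloorAllGroupsExplicit
import Literature.MathematicalPhysics.QuantumFieldTheory.YangMillsOS
import Literature.MathematicalPhysics.QuantumLattice.GaugeGroupsProofs
import Literature.MathematicalPhysics.QuantumLattice.RepLieAlgebraUnitary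

/-!
# Crux `BoxAllWindowsSU22` (stmt-QuantumFields-22910, route `AllWindowsColdBox`): the SMALL windows `θ ≤ 1/100` are settled for EVERY `A`

`BoxAllWindowsSU22 := ∀ A θ, 0 < A → A < θ → θ ≤ 7A → ∃ c > 0, BoxTwoPointDomination (SU(2), fundamental) A θ c`.  The proved one-scale
theorem of record, `ColdBoxTwoPointFloorW` (route `WeakCouplingRates`), is `∃ θ₀`-packaged, so by itself it does not say which windows
`(A, θ)` it covers.  The explicit-ceiling form of the all-groups crux (`boxTwoPointDomination_allGroups_explicit'`,
`Theorems/ColdBoxAllGroupsBoxFloorAllGroupsExplicit.lean`: ceiling `θ₀ = 1/100` for every compact simple `G` and every faithful unitary `r`)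
specialised to `G = SU(2)`, `r =` fundamental gives:

* `boxAllWindowsSU22_smallWindows` — for ALL `0 < A < θ ≤ 1/100` (no relation between `θ` and `A` required) some `c > 0` has
  `BoxTwoPointDomination (fundamentalRep (Fin 2)) A θ c`;
* `boxAllWindowsSU22_of_le` — hence the crux's window `A < θ ≤ 7A` is settled whenever `θ ≤ 1/100` (in particular for every `A ≤ 1/700`).

What remains OPEN of `BoxAllWindowsSU22` is exactly the regime `1/100 < θ ≤ 7A` (boxes `β^θ` beyond the one-scale Laplace window: the
multi-scale content named in the item).  No sorry; no new definition; standard axioms.  NOT the Yang–Mills mass gap and not the crux itself: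
a finite-volume weak-coupling covariance floor in the one-scale window (RECORD-label rung level); no summit statement is proved.
-/

set_option autoImplicit false

noncomputable section

namespace Summit.QuantumFields.YangMills.Theorems.AllWindowsColdBox

open Literature.MathematicalPhysics.QuantumFieldTheory Literature.MathematicalPhysics.QuantumLattice
open Summit.QuantumFields.YangMills.Theorems.WeakCouplingRates
open Summit.QuantumFields.YangMills.Theorems.ColdBoxAllGroups

/-- **Small windows of `BoxAllWindowsSU22`, all of them at once**: for all `0 < A < θ ≤ 1/100` there is `c > 0` with
`BoxTwoPointDomination (fundamentalRep (Fin 2)) A θ c` — for large `β`, `β²·boxPlaqCov β ⌈β^θ⌉ ⌈β^A⌉ ≥ c·C(⌈β^A⌉)²` in the cold-wall `SU(2)` box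
(the all-groups explicit ceiling `boxTwoPointDomination_allGroups_explicit'` at `G = SU(2)`, which is compact simple in the tree sense by
`isSimpleCompactGroup_specialUnitaryGroup_holds`, and its fundamental `LatticeRep` `fundamentalLatticeRep 2`).  NOT the Clay mass gap. -/
theorem boxAllWindowsSU22_smallWindows :
    ∀ A θ : ℝ, 0 < A → A < θ → θ ≤ 1 / 100 → ∃ c : ℝ, 0 < c ∧
      BoxTwoPointDomination (G := Matrix.specialUnitaryGroup (Fin 2) ℂ) (fundamentalRep (Fin 2)) A θ c :=
  fun A θ hA hAθ hθ =>
    boxTwoPointDomination_allGroups_explicit' (Matrix.specialUnitaryGroup (Fin 2) ℂ)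
      (isCompactSimpleLieGroup_specialUnitaryGroup isSimpleCompactGroup_specialUnitaryGroup_holds (by norm_num))
      (fundamentalLatticeRep 2) A θ hA hAθ hθ

/-- **The crux's window below the one-scale ceiling**: for `0 < A < θ ≤ 7A` with `θ ≤ 1/100` (e.g. every `A ≤ 1/700` and every admissible
`θ`), `∃ c > 0, BoxTwoPointDomination (fundamentalRep (Fin 2)) A θ c` — literally the body of `BoxAllWindowsSU22` under the extra hypothesis
`θ ≤ 1/100`; the open part of the crux is `θ > 1/100`.  NOT the Clay mass gap. -/
theorem boxAllWindowsSU22_of_le :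
    ∀ A θ : ℝ, 0 < A → A < θ → θ ≤ 7 * A → θ ≤ 1 / 100 → ∃ c : ℝ, 0 < c ∧
      BoxTwoPointDomination (G := Matrix.specialUnitaryGroup (Fin 2) ℂ) (fundamentalRep (Fin 2)) A θ c :=
  fun A θ hA hAθ _ hθ => boxAllWindowsSU22_smallWindows A θ hA hAθ hθ

end Summit.QuantumFields.YangMills.Theorems.AllWindowsColdBox

end
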